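import Literature.Geometry.ComplexAnalytic.RelativeExponentialChart
import Mathlib.Geometry.Manifold.MFDeriv.SpecificFunctions
import Mathlib.Analysis.Normed.Operator.BoundedLinearMaps
import HarnessLib

/-!
# The marked-family hom criterion: a fibrewise-linear map of analytic families of complex tori which respects the period lattices
# and is holomorphic in the exponential charts IS a holomorphic map of families ([BirkenhakeLange2004] §1.2 Prop. 1.2.1 in families;
# [Shimura1963AnalyticFamilies] §2)

Layer `Literature/Geometry/ComplexAnalytic`, namespace `Literature.Geometry.ComplexAnalytic.IsRelExpChartOn` (dot notation on the ★ U6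
currency `IsRelExpChartOn`, `RelativeExponentialChart.lean`).  THEOREMS ONLY (no definition, no named fact, no instance, no notation, no
`sorry`).  Cell `hodgecm-mathlib` (D-0151), FLOOR 0, P6 «MOD» (crux hLiu418 = stmt-HodgeConjecture-24832, `--supports`), organ **U6-b
`MarkedFamilyHomCriterion`** of LEAD F0P6-plan (g2)'s ruling M-17m″ (I-1) (A-p06 (g32), E6 owner).  Consumers: the E6 closer of
`Cruxes/HLiu418/Lines/F0_P6a_PELWitnessE.lean` (`stub_E6`: the lattice reading `Mρ a b` of ★ `AuxChartGS`, `ℂ`-linear on every fibre by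
`Mρ_kottwitz`, becomes a HOLOMORPHIC endomorphism of the analytified family, then algebraic by GAGA ★ `arapura2012_cor_15_4_6_holds`), and U6-c
`SiegelUniversalFamilyPeriods` (uniqueness: two charts with the same period map are isomorphic).  HC_CM is proved only modulo the printed citations
until rung 0 closes; this file is generic and changes no count.

THE MATHEMATICS.  Let `ex : B × E → M` and `ex′ : B × E′ → M′` be relative exponential charts over the same open `U ⊆ B` of two families
`p : M → B`, `p′ : M′ → B` (★ `IsRelExpChartOn`), and `C b : E → E′` (`b ∈ B`) maps.  (1) If `C b` carries the period lattice `Φ b (ℤ^ι)` into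
`Φ′ b (ℤ^ι′)` additively, the fibrewise recipe `y (ex (b, z)) := ex′ (b, C b z)` is WELL DEFINED over `U` (`ex (b, ·)` is onto the fibre with
kernel the lattice) and unique there.  (2) If moreover `(b, z) ↦ C b z` is holomorphic on `U × E`, then `y` is HOLOMORPHIC at every point over `U`:
`ex` is étale with holomorphic local inverses `e⁻¹`, and near any point `y = ex′ ∘ (fst, C) ∘ e⁻¹`.  This is [BirkenhakeLange2004] Prop. 1.2.1
(«a holomorphic map of complex tori lifts to a `ℂ`-linear map of the universal covers respecting the lattices, and conversely») run in a
family; with `C b` the `ℂ`-linear avatar of a CONSTANT integral matrix it is the classical statement that an endomorphism of the period lattice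
which is `ℂ`-linear for every complex structure of the family is an endomorphism of the family ([Shimura1963AnalyticFamilies] §2).

* §1 `exists_map_comp_ex_eq` (existence of `y` over `U`, lying over `B`), `eq_of_comp_ex_eq` (uniqueness over `U`).
* §2 **`mdifferentiableAt_of_comp_ex_eq`** (holomorphy at points over `U`), `mdifferentiableOn_of_comp_ex_eq`, `mdifferentiableOn_uncurry_clm`
  (operator-valued holomorphy ⇒ joint holomorphy).
* §3 **`exists_mdifferentiableOn_comp_ex_eq`** — THE HEAD: existence + holomorphy + uniqueness for a holomorphic family `C b : E →L[ℂ] E′`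
  carrying periods to periods.

## References
* [BirkenhakeLange2004] C. Birkenhake, H. Lange, *Complex Abelian Varieties*, 2nd ed. (2004), §1.2 Proposition 1.2.1 (homomorphisms of complex
  tori = `ℂ`-linear maps respecting the lattices).
* [Shimura1963AnalyticFamilies] G. Shimura, *On analytic families of polarized abelian varieties and automorphic functions*, Ann. Math. 78 (1963), §2.
-/

set_option autoImplicit false

noncomputable section

open scoped Manifold

namespace Literature.Geometry.ComplexAnalytic

variable {EB : Type*} [NormedAddCommGroup EB] [NormedSpace ℂ EB] {B : Type*} [TopologicalSpace B] [ChartedSpace EB B]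
  {E : Type*} [NormedAddCommGroup E] [NormedSpace ℂ E] {ι : Type*}
  {EM : Type*} [NormedAddCommGroup EM] [NormedSpace ℂ EM] {M : Type*} [TopologicalSpace M] [ChartedSpace EM M]

namespace IsRelExpChartOn

variable {E' : Type*} [NormedAddCommGroup E'] [NormedSpace ℂ E'] {ι' : Type*}
  {EM' : Type*} [NormedAddCommGroup EM'] [NormedSpace ℂ EM'] {M' : Type*} [TopologicalSpace M'] [ChartedSpace EM' M']
  {p : M → B} {p' : M' → B} {U : Set B} {Φ : B → ((ι → ℝ) ≃L[ℝ] E)} {Φ' : B → ((ι' → ℝ) ≃L[ℝ] E')}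
  {ex : B × E → M} {ex' : B × E' → M'}

/-! ## §1 Existence and uniqueness of the fibrewise map -/

/-- **A fibrewise map which respects the period lattices descends to the families** ([BirkenhakeLange2004] §1.2, Prop. 1.2.1 for one
torus: «a homomorphism of complex tori is given by a `ℂ`-linear map of the universal covers taking the lattice into the lattice», here
in a family over `U`): given relative exponential charts `ex` of `p : M → B` and `ex′` of `p′ : M′ → B` over the same open `U`, and maps
`C b : E → E′` such that `C b (z + Φ b n) - C b z` is a period of `ex′` for every period `Φ b n` of `ex` (`b ∈ U`), there is a map
`y : M → M′` with `y (ex (b, z)) = ex′ (b, C b z)` over `U`; it lies over `B`. [cite: BirkenhakeLange2004, §1.2 Proposition 1.2.1] -/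
theorem exists_map_comp_ex_eq (h : IsRelExpChartOn EB EM p U Φ ex) (h' : IsRelExpChartOn EB EM' p' U Φ' ex') (C : B → E → E')
    (hC : ∀ b ∈ U, ∀ (z : E) (n : ι → ℤ), ∃ n' : ι' → ℤ,
      C b (z + Φ b (fun i => (n i : ℝ))) = C b z + Φ' b (fun i => (n' i : ℝ))) :
    ∃ y : M → M', (∀ b ∈ U, ∀ z : E, y (ex (b, z)) = ex' (b, C b z)) ∧ ∀ m : M, p m ∈ U → p' (y m) = p m := by
  classical
  -- a lift of every point over `U`
  have hz : ∀ m : M, p m ∈ U → ∃ z : E, ex (p m, z) = m := h.ex_surj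
  let lift : M → E := fun m => if hm : p m ∈ U then (hz m hm).choose else 0
  have hlift : ∀ m : M, p m ∈ U → ex (p m, lift m) = m := by
    intro m hm
    simp only [lift, dif_pos hm]
    exact (hz m hm).choose_spec
  refine ⟨fun m => ex' (p m, C (p m) (lift m)), ?_, ?_⟩
  · intro b hb z
    have hpb : p (ex (b, z)) = b := h.p_ex b hb z
    -- the chosen lift differs from `z` by a period
    have hzl : ex (b, lift (ex (b, z))) = ex (b, z) := by
      have := hlift (ex (b, z)) (hpb.symm ▸ hb)
      rwa [hpb] at this
    obtain ⟨n, hn⟩ := h.exists_int_of_ex_eq hb hzl.symm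
    -- hn : lift (ex (b, z)) = z + Φ b n  (from `ex (b, z) = ex (b, lift …)`)
    obtain ⟨n', hn'⟩ := hC b hb z n
    simp only [hpb]
    rw [hn, hn', h'.ex_add_period hb]
  · intro m hm
    exact h'.p_ex (p m) hm _

omit [TopologicalSpace M'] in
/-- **Uniqueness**: two maps `M → M′` with the same composite with `ex` over `U` agree over `U` (`ex (b, ·)` is onto the fibres).
[cite: BirkenhakeLange2004, §1.2 Proposition 1.2.1] -/
theorem eq_of_comp_ex_eq (h : IsRelExpChartOn EB EM p U Φ ex) {y₁ y₂ : M → M'}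
    (hy : ∀ b ∈ U, ∀ z : E, y₁ (ex (b, z)) = y₂ (ex (b, z))) {m : M} (hm : p m ∈ U) : y₁ m = y₂ m := by
  obtain ⟨z, hz⟩ := h.ex_surj m hm
  rw [← hz]
  exact hy (p m) hm z

/-! ## §2 Holomorphy -/

/-- **THE CRITERION — a map of families which is holomorphic-linear in the exponential charts is holomorphic** ([BirkenhakeLange2004] §1.2
Prop. 1.2.1 in a family; [Shimura1963AnalyticFamilies] §2): if `y : M → M′` satisfies `y (ex (b, z)) = ex′ (b, C b z)` over `U` with
`(b, z) ↦ C b z` holomorphic on `U × E`, then `y` is holomorphic at every point over `U` — because `ex` admits holomorphic local inverses, through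
which `y` is locally the composite `ex′ ∘ (id × C) ∘ ex⁻¹`. [cite: BirkenhakeLange2004, §1.2 Proposition 1.2.1] [cite: Shimura1963AnalyticFamilies, §2] -/
theorem mdifferentiableAt_of_comp_ex_eq (h : IsRelExpChartOn EB EM p U Φ ex) (h' : IsRelExpChartOn EB EM' p' U Φ' ex') {C : B → E → E'}
    (hC : MDifferentiableOn (𝓘(ℂ, EB).prod 𝓘(ℂ, E)) 𝓘(ℂ, E') (fun q : B × E => C q.1 q.2) (U ×ˢ Set.univ))
    {y : M → M'} (hy : ∀ b ∈ U, ∀ z : E, y (ex (b, z)) = ex' (b, C b z)) {m : M} (hm : p m ∈ U) :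
    MDifferentiableAt 𝓘(ℂ, EM) 𝓘(ℂ, EM') y m := by
  obtain ⟨z, hz⟩ := h.ex_surj m hm
  obtain ⟨e, hxe, hsrc, heq, hd⟩ := h.exists_localInverse (p m, z) ⟨hm, Set.mem_univ _⟩
  -- `m = e (p m, z)` lies in the open target of `e`
  have hem : e (p m, z) = m := by rw [heq _ hxe, hz]
  have hmt : m ∈ e.target := hem ▸ e.map_source hxe
  -- near `m`, `y = ex' ∘ (fst, C) ∘ e.symm`
  have hloc : y =ᶠ[nhds m] fun m'' => ex' ((e.symm m'').1, C (e.symm m'').1 (e.symm m'').2) := by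
    filter_upwards [e.open_target.mem_nhds hmt] with m'' hm''
    have hs : e.symm m'' ∈ e.source := e.map_target hm''
    have hb : (e.symm m'').1 ∈ U := (hsrc hs).1
    have hexm : ex (e.symm m'') = m'' := by rw [← heq _ hs, e.right_inv hm'']
    calc y m'' = y (ex ((e.symm m'').1, (e.symm m'').2)) := by rw [Prod.mk.eta, hexm]
      _ = ex' ((e.symm m'').1, C (e.symm m'').1 (e.symm m'').2) := hy _ hb _
  refine MDifferentiableAt.congr_of_eventuallyEq ?_ hloc
  -- the three factors are holomorphic
  have h1 : MDifferentiableAt 𝓘(ℂ, EM) (𝓘(ℂ, EB).prod 𝓘(ℂ, E)) e.symm m :=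
    (hd m hmt).mdifferentiableAt (e.open_target.mem_nhds hmt)
  have hsm : e.symm m ∈ U ×ˢ (Set.univ : Set E) := hsrc (e.map_target hmt)
  have h2 : MDifferentiableAt (𝓘(ℂ, EB).prod 𝓘(ℂ, E)) (𝓘(ℂ, EB).prod 𝓘(ℂ, E'))
      (fun q : B × E => (q.1, C q.1 q.2)) (e.symm m) :=
    mdifferentiableAt_fst.prodMk (hC.mdifferentiableAt ((h.isOpen.prod isOpen_univ).mem_nhds hsm))
  have h3 : MDifferentiableAt (𝓘(ℂ, EB).prod 𝓘(ℂ, E')) 𝓘(ℂ, EM') ex' ((e.symm m).1, C (e.symm m).1 (e.symm m).2) :=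
    h'.mdifferentiableOn_ex.mdifferentiableAt ((h'.isOpen.prod isOpen_univ).mem_nhds ⟨hsm.1, Set.mem_univ _⟩)
  exact h3.comp m (h2.comp m h1)

/-- **All over `U` at once.** [cite: BirkenhakeLange2004, §1.2 Proposition 1.2.1] -/
theorem mdifferentiableOn_of_comp_ex_eq (h : IsRelExpChartOn EB EM p U Φ ex) (h' : IsRelExpChartOn EB EM' p' U Φ' ex')
    {C : B → E → E'} (hC : MDifferentiableOn (𝓘(ℂ, EB).prod 𝓘(ℂ, E)) 𝓘(ℂ, E') (fun q : B × E => C q.1 q.2) (U ×ˢ Set.univ))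
    {y : M → M'} (hy : ∀ b ∈ U, ∀ z : E, y (ex (b, z)) = ex' (b, C b z)) :
    MDifferentiableOn 𝓘(ℂ, EM) 𝓘(ℂ, EM') y (p ⁻¹' U) :=
  fun _ hm => (h.mdifferentiableAt_of_comp_ex_eq h' hC hy hm).mdifferentiableWithinAt

/-- **Operator-valued form of the holomorphy hypothesis**: if `b ↦ C b ∈ (E →L[ℂ] E′)` is holomorphic on `U`, then `(b, z) ↦ C b z` is
holomorphic on `U × E` (evaluation is a bounded bilinear map). [cite: BirkenhakeLange2004, §1.2] -/
theorem mdifferentiableOn_uncurry_clm {C : B → (E →L[ℂ] E')} (hU : IsOpen U)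
    (hC : MDifferentiableOn 𝓘(ℂ, EB) 𝓘(ℂ, E →L[ℂ] E') C U) :
    MDifferentiableOn (𝓘(ℂ, EB).prod 𝓘(ℂ, E)) 𝓘(ℂ, E') (fun q : B × E => C q.1 q.2) (U ×ˢ Set.univ) := by
  intro q hq
  have h1 : MDifferentiableAt (𝓘(ℂ, EB).prod 𝓘(ℂ, E)) 𝓘(ℂ, (E →L[ℂ] E') × E) (fun q : B × E => (C q.1, q.2)) q :=
    ((hC.mdifferentiableAt (hU.mem_nhds hq.1)).comp q mdifferentiableAt_fst).prodMk_space mdifferentiableAt_snd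
  have h2 : MDifferentiableAt 𝓘(ℂ, (E →L[ℂ] E') × E) 𝓘(ℂ, E') (fun w : (E →L[ℂ] E') × E => w.1 w.2) (C q.1, q.2) :=
    (isBoundedBilinearMap_apply.differentiableAt _).mdifferentiableAt
  exact (h2.comp q h1).mdifferentiableWithinAt

/-! ## §3 The head -/

/-- **THE HEAD — existence, uniqueness and holomorphy together** (the «marked family hom criterion»): for a holomorphic family of
`ℂ`-linear maps `C b : E →L[ℂ] E′` over `U` carrying periods to periods (`C b ∘ Φ b = Φ′ b ∘ N b` on `ℤ^ι` for integral `N b`), there is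
`y : M → M′`, holomorphic over `U`, with `y ∘ ex = ex′ ∘ (id × C)` over `U`, and it is unique over `U`.  In E6: `C b` = the `ℂ`-linear avatar of
the lattice reading `Mρ a b` (★ `AuxChartGS.Mρ_kottwitz`), `N b = Mρ a b`. [cite: BirkenhakeLange2004, §1.2 Proposition 1.2.1] [cite: Shimura1963AnalyticFamilies, §2] -/
theorem exists_mdifferentiableOn_comp_ex_eq (h : IsRelExpChartOn EB EM p U Φ ex) (h' : IsRelExpChartOn EB EM' p' U Φ' ex')
    (C : B → (E →L[ℂ] E')) (hC : MDifferentiableOn 𝓘(ℂ, EB) 𝓘(ℂ, E →L[ℂ] E') C U)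
    (N : B → ((ι → ℤ) → (ι' → ℤ)))
    (hN : ∀ b ∈ U, ∀ n : ι → ℤ, C b (Φ b (fun i => (n i : ℝ))) = Φ' b (fun i => (N b n i : ℝ))) :
    ∃ y : M → M', (∀ b ∈ U, ∀ z : E, y (ex (b, z)) = ex' (b, C b z)) ∧ (∀ m : M, p m ∈ U → p' (y m) = p m) ∧
      MDifferentiableOn 𝓘(ℂ, EM) 𝓘(ℂ, EM') y (p ⁻¹' U) ∧
      ∀ y' : M → M', (∀ b ∈ U, ∀ z : E, y' (ex (b, z)) = ex' (b, C b z)) → ∀ m : M, p m ∈ U → y' m = y m := by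
  obtain ⟨y, hy, hp⟩ := h.exists_map_comp_ex_eq h' (fun b z => C b z) (fun b hb z n => ⟨N b n, by
    rw [map_add, hN b hb n]⟩)
  exact ⟨y, hy, hp, h.mdifferentiableOn_of_comp_ex_eq h' (mdifferentiableOn_uncurry_clm h.isOpen hC) hy,
    fun y' hy' m hm => h.eq_of_comp_ex_eq (fun b hb z => by rw [hy' b hb z, hy b hb z]) hm⟩

end IsRelExpChartOn

end Literature.Geometry.ComplexAnalytic

end
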